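import Literature.Barriers.RiemannHypothesis.GramRosserFailuresLehmanProofs
import Literature.NumberTheory.LFunctions.BohrLandauArgS
import Literature.NumberTheory.LFunctions.ZetaZerosOffLine
import HarnessLib

/-!
# The Bohr–Landau route to the Gram/Rosser failures (Titchmarsh 1935; Trudgian §4.3, footnote 6)

Sibling of `GramRosserFailures.lean` / `GramRosserFailuresLehmanProofs.lean`. The latter proves
Trudgian's Theorem 7.3 (the Weak Rosser Rule fails beyond every height) and Titchmarsh's
"infinitely many bad Gram points" from Selberg's `Ω`-theorem for `S(t)` (Trudgian eq. (41)). The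
*older* printed route — Titchmarsh 1935 for Gram's law (Trudgian §4.3, pp. 239–240), and for
Rosser's rule Trudgian's footnote 6 ("a proof that the Rosser Rule implies only finitely many
exceptions to the Riemann hypothesis can be given (see [6, pp. 180–181]). Then the theorem of Bohr
and Landau (Theorem 4.2) may be applied") and Edwards §8.4 — needs instead two classical inputs:

1. **Littlewood 1924**: `∫₀ᵀ S(t) dt = O(log T)` (Trudgian (37)) — *proved* in the tree,
   `Literature.NumberTheory.LFunctions.exists_abs_integral_zetaArgS_le` (`ZetaArgVariation.lean`);
2. **Landau 1911 / Bohr–Landau 1913**: if only finitely many zeros of `ζ` lie off the critical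
   line, `S(t)` is not bounded below on any ray — the named fact
   `Literature.NumberTheory.LFunctions.Landau1911_zetaArgS_not_bddBelow` (`BohrLandauArgS.lean`,
   Edwards §9.8, where Bohr's 1910 theorem it rests on is already proved).

This file formalises that route, so that the barrier `GramRosserFailures` is available
conditionally on *either* named fact (`GramRosserFailures_of_selberg`, `GramRosserFailures_of_landau`):

* `criticalZeroCount_ge_of_weakRosser` — under the Weak Rosser Rule beyond `T₀`:
  `N₀(t) ≥ θ(t)/π + N₀(g_{a₀}) − a₀ − 5` for `t ≥ g_{a₀}` (Trudgian's (40): "`N₀(t) ≥ π⁻¹θ(t) − 1 − n₁`");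
* `exists_forall_re_eq_half_of_criticalZeroCount_ge` — **a lower bound `N₀(t) ≥ θ(t)/π − C` on a
  ray forces all but finitely many zeros onto the line** (Trudgian: "Therefore the number of complex
  zeroes of `ζ(s)` not on the line `σ = 1/2` is finite"; here via Littlewood's theorem directly:
  unboundedly many zeros off the line would make `S = (N − N₀) + N₀ − θ/π − 1 ≥ 1` on a ray,
  contradicting `∫ S = O(log T)`; the bounded case is `exists_forall_re_eq_half_of_zetaZeroCount_le`
  of `ZetaZerosOffLine.lean`);
* `zetaArgS_ge_of_criticalZeroCount_ge` — the same bound makes `S` bounded below on the ray;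
* `not_exists_criticalZeroCount_ge_of_landau` — hence, given Landau's theorem, no such bound exists;
* `TrudgianGram2011_thm7_3_of_landau`, `Titchmarsh1935_badGramPoints_of_landau`,
  `GramRosserFailures_of_landau`.

## References

* T. Trudgian, *On the success and failure of Gram's Law and the Rosser Rule*, Acta Arith. 148
  (2011), 225–256: §4.2 (36)–(37), Thm. 4.2, §4.3 (pp. 239–240, (40)), Thm. 7.3 and footnote 6.
* H. M. Edwards, *Riemann's Zeta Function* (1974), §8.4 (pp. 178–181), §9.8 (pp. 201–203).
* E. C. Titchmarsh, *The zeros of the Riemann zeta-function*, Proc. Roy. Soc. London A 151 (1935),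
  234–255; *The Theory of the Riemann Zeta-Function*, 2nd ed. (1986), Thm. 9.9 (A), §10.6.
-/

noncomputable section

open Filter Set MeasureTheory intervalIntegral
open scoped Real Topology

namespace Literature.Barriers.RiemannHypothesis

open Literature.NumberTheory.LFunctions

/-! ### `N₀` under the eventual Weak Rosser Rule -/

section GramSeq

variable {g : ℕ → ℝ}

/-- Every `t ≥ g_{a₀}` lies in a Gram interval `[g_j, g_{j+1})` with `j ≥ a₀`. [cite: Edwards1974, §6.5] -/
theorem exists_gramPoint_le_lt (hg : ∀ n, IsGramPoint n (g n)) {a₀ : ℕ} {t : ℝ} (ht : g a₀ ≤ t) :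
    ∃ j : ℕ, a₀ ≤ j ∧ g j ≤ t ∧ t < g (j + 1) := by
  classical
  have hmono := strictMono_of_isGramPoint hg
  have hex : ∃ j : ℕ, t < g (j + 1) := by
    obtain ⟨n, hn⟩ := exists_le_gramPoint hg (t + 1)
    exact ⟨n, by linarith [hmono.monotone (Nat.le_add_right n 1)]⟩
  set j := Nat.find hex with hj
  have hj1 : t < g (j + 1) := Nat.find_spec hex
  have hj0 : g j ≤ t := by
    rcases Nat.eq_zero_or_pos j with h0 | hpos
    · rw [h0]
      exact (hmono.monotone (Nat.zero_le a₀)).trans ht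
    · have hmin := Nat.find_min hex (show j - 1 < j by omega)
      rw [show j - 1 + 1 = j by omega, not_lt] at hmin
      exact hmin
  refine ⟨j, ?_, hj0, hj1⟩
  by_contra hlt
  push Not at hlt
  have := hmono.monotone (show j + 1 ≤ a₀ by omega)
  linarith

/-- At a Gram interval: `θ(t)/π < j + 1` for `t < g_{j+1}` (`t ≥ 7`). [cite: Edwards1974, §6.5] -/
theorem riemannSiegelTheta_div_pi_lt (hg : ∀ n, IsGramPoint n (g n)) {j : ℕ} {t : ℝ} (h7 : 7 ≤ t)
    (ht : t < g (j + 1)) : riemannSiegelTheta t / π < j + 1 := by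
  have hθ : riemannSiegelTheta t < ((j + 1 : ℕ) : ℝ) * π := by
    rw [← (hg (j + 1)).2]
    exact strictMonoOn_riemannSiegelTheta_Ici_seven h7
      (show (7 : ℝ) ≤ g (j + 1) by linarith [(hg (j + 1)).1]) ht
  rw [div_lt_iff₀ Real.pi_pos]
  push_cast at hθ
  linarith

/-- **`N₀(t) ≥ θ(t)/π − C` under the eventual Weak Rosser Rule** (the analogue of Trudgian's (40)
for Rosser's rule): if the Weak Rosser Rule holds in every Gram block `(g_n, g_{n+l}]` with
`g_n ≥ T₀` and `g_{a₀} ≥ T₀`, then `θ(t)/π + N₀(g_{a₀}) − a₀ − 5 ≤ N₀(t)` for all `t ≥ g_{a₀}`.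
[cite: TrudgianGram2011, §4.3 (40) and Thm. 7.3] -/
theorem criticalZeroCount_ge_of_weakRosser (hg : ∀ n, IsGramPoint n (g n)) {T₀ : ℝ} {a₀ : ℕ}
    (ha₀ : T₀ ≤ g a₀) (H : ∀ n l, IsGramBlock n l g → T₀ ≤ g n → WeakRosserRule n l g)
    {t : ℝ} (ht : g a₀ ≤ t) :
    riemannSiegelTheta t / π + criticalZeroCount (g a₀) - a₀ - 5 ≤ criticalZeroCount t := by
  obtain ⟨j, haj, hj0, hj1⟩ := exists_gramPoint_le_lt hg ht
  have hchain := criticalZeroCount_add_le_of_weakRosser hg ha₀ H haj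
  have hNt : criticalZeroCount (g j) ≤ criticalZeroCount t := criticalZeroCount_mono hj0
  have hθ := riemannSiegelTheta_div_pi_lt hg (by linarith [(hg j).1]) hj1
  have h1 : (criticalZeroCount (g a₀) : ℝ) + j ≤ criticalZeroCount (g j) + a₀ + 4 := by
    exact_mod_cast hchain
  have h2 : (criticalZeroCount (g j) : ℝ) ≤ criticalZeroCount t := by exact_mod_cast hNt
  linarith

/-- If every Gram point `g_n`, `n ≥ M`, is good, then every Gram block beyond `g_M` has length one
and obeys the Weak Rosser Rule (parity: `Z(g_n) Z(g_{n+1}) < 0` forces an odd number of zeros in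
`(g_n, g_{n+1}]`). [cite: TrudgianGram2011, §2 and §7.2] -/
theorem weakRosserRule_of_forall_isGoodGram (hg : ∀ n, IsGramPoint n (g n)) {M : ℕ}
    (hM : ∀ n, M ≤ n → IsGoodGram n (g n)) :
    ∀ n l, IsGramBlock n l g → g M ≤ g n → WeakRosserRule n l g := by
  have hmono := strictMono_of_isGramPoint hg
  rintro n l ⟨hl, -, hgoodn, hgoodnl, hint⟩ hMn
  have hMn' : M ≤ n := hmono.le_iff_le.1 hMn
  have hl1 : l = 1 := by
    by_contra hl1
    exact hint (n + 1) (by omega) (by omega) (hM (n + 1) (by omega))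
  subst hl1
  have hZn : hardyZ (g n) ≠ 0 := fun h0 ↦ by simp [IsGoodGram, h0] at hgoodn
  have hZn1 : hardyZ (g (n + 1)) ≠ 0 := fun h0 ↦ by simp [IsGoodGram, h0] at hgoodnl
  have hpar := gramPoint_parity hg (Nat.le_add_right n 1) hZn hZn1
  have heven := even_of_neg_one_pow_mul_pos (mul_pos hgoodn hgoodnl) hpar
  rw [Nat.even_iff] at heven
  change 1 + criticalZeroCount (g n) ≤ criticalZeroCount (g (n + 1))
  have hmono' := criticalZeroCount_mono (hmono.monotone (Nat.le_add_right n 1))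
  omega

/-- If only finitely many Gram points are bad, all Gram points from some index on are good.
[cite: TrudgianGram2011, §4.3] -/
theorem exists_forall_isGoodGram_of_not_badGramPoints (hg : ∀ n, IsGramPoint n (g n))
    (hfin : ¬ Titchmarsh1935_badGramPoints) : ∃ M : ℕ, ∀ n, M ≤ n → IsGoodGram n (g n) := by
  rw [Titchmarsh1935_badGramPoints, Set.not_infinite] at hfin
  obtain ⟨M, hM⟩ := hfin.bddAbove
  refine ⟨M + 1, fun n hn ↦ ?_⟩
  by_contra hbad
  have hmem : n ∈ {n : ℕ | ∃ g : ℝ, IsGramPoint n g ∧ ¬ IsGoodGram n g} := ⟨g n, hg n, hbad⟩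
  have := hM hmem
  omega

end GramSeq

/-! ### Littlewood's theorem: a lower bound `N₀ ≥ θ/π − C` leaves finitely many zeros off the line -/

/-- **Littlewood's theorem leaves only finitely many zeros off the line under a Gram-type lower
bound for `N₀`.** If `θ(t)/π − C ≤ N₀(t)` for all `t ≥ T₀`, then beyond some height every zero of
`ζ` lies on the critical line. For if `N − N₀` is bounded this is
`exists_forall_re_eq_half_of_zetaZeroCount_le` (`ZetaZerosOffLine.lean`); otherwise `N − N₀`, being
non-decreasing, exceeds `m ≥ C + 2` beyond some `T₁`, so `S(t) = N(t) − θ(t)/π − 1 ≥ 1` for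
`t ≥ T₁`, whence `∫_{T₁}^T S ≥ T − T₁`, contradicting Littlewood's
`|∫_{T₁}^T S| ≤ A log(T + 4) + B` (`exists_abs_integral_zetaArgS_le`). (Trudgian §4.3: "Therefore
the number of complex zeroes of `ζ(s)` not on the line `σ = 1/2` is finite"; Edwards §8.4: "since
otherwise `S(t)` would eventually be large and positive".) [cite: TrudgianGram2011, §4.3] -/
theorem exists_forall_re_eq_half_of_criticalZeroCount_ge {C T₀ : ℝ}
    (hC : ∀ t, T₀ ≤ t → riemannSiegelTheta t / π - C ≤ criticalZeroCount t) :
    ∃ q : ℝ, ∀ ρ : ℂ, riemannZeta ρ = 0 → q < ρ.im → ρ.re = 1 / 2 := by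
  by_cases hbdd : ∃ B : ℕ, ∀ T : ℝ, zetaZeroCount T ≤ criticalZeroCount T + B
  · obtain ⟨B, hB⟩ := hbdd
    exact exists_forall_re_eq_half_of_zetaZeroCount_le hB
  exfalso
  push Not at hbdd
  obtain ⟨A, B, hA, hB, hLitt⟩ := exists_abs_integral_zetaArgS_le
  obtain ⟨m, hm⟩ := exists_nat_ge (C + 2)
  obtain ⟨Tm, hTm⟩ := hbdd m
  set T₁ : ℝ := max (max T₀ 2) Tm with hT₁
  have hT₁0 : T₀ ≤ T₁ := (le_max_left _ _).trans (le_max_left _ _)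
  have hT₁2 : 2 ≤ T₁ := (le_max_right _ _).trans (le_max_left _ _)
  have hT₁m : Tm ≤ T₁ := le_max_right _ _
  -- `S(t) ≥ 1` for `t ≥ T₁`
  have hS1 : ∀ t, T₁ ≤ t → 1 ≤ zetaArgS t := by
    intro t ht
    have hmono := zetaZeroCount_add_criticalZeroCount_le (hT₁m.trans ht)
    have hC' := hC t (hT₁0.trans ht)
    have h1 : (criticalZeroCount t : ℝ) + m + 1 ≤ zetaZeroCount t := by
      have : criticalZeroCount t + m + 1 ≤ zetaZeroCount t := by omega
      exact_mod_cast this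
    rw [zetaArgS]
    linarith
  -- a large `T` with `log T ≤ T / (4A + 4)`
  have hev : ∀ᶠ T in atTop, T₁ ≤ T ∧ 4 ≤ T ∧ 2 * (B + T₁) + 2 ≤ T ∧
      |Real.log T| ≤ 1 / (4 * A + 4) * |T| := by
    have hlog := Real.isLittleO_log_id_atTop.def (show (0 : ℝ) < 1 / (4 * A + 4) by positivity)
    filter_upwards [eventually_ge_atTop T₁, eventually_ge_atTop (4 : ℝ),
      eventually_ge_atTop (2 * (B + T₁) + 2), hlog] with T h1 h2 h3 h4
    exact ⟨h1, h2, h3, by simpa only [Real.norm_eq_abs, id_eq] using h4⟩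
  obtain ⟨T, hTT₁, hT4, hTB, hlogT⟩ := hev.exists
  -- lower bound for the integral
  have hLB : T - T₁ ≤ ∫ t in T₁..T, zetaArgS t := by
    have h := intervalIntegral.integral_mono_on hTT₁ intervalIntegrable_const
      (intervalIntegrable_zetaArgS T₁ T) (fun t ht ↦ hS1 t ht.1)
    rwa [intervalIntegral.integral_const, smul_eq_mul, mul_one] at h
  -- Littlewood's upper bound
  have hUB := (le_abs_self _).trans (hLitt T₁ T hT₁2 hTT₁)
  have hlog2 : Real.log (T + 4) ≤ 2 * Real.log T := by
    rw [← Real.log_rpow (by linarith), Real.rpow_two]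
    exact Real.log_le_log (by linarith) (by nlinarith)
  have hlogT' : Real.log T ≤ 1 / (4 * A + 4) * T := by
    rwa [abs_of_pos (Real.log_pos (by linarith)), abs_of_pos (show (0 : ℝ) < T by linarith)]
      at hlogT
  have hfrac : A / (2 * A + 2) ≤ 1 / 2 := by
    rw [div_le_iff₀ (by positivity)]
    linarith
  have hAT : A * Real.log (T + 4) ≤ T / 2 :=
    calc A * Real.log (T + 4) ≤ A * (2 * Real.log T) := by gcongr
      _ ≤ A * (2 * (1 / (4 * A + 4) * T)) := by gcongr
      _ = A / (2 * A + 2) * T := by field_simp; ring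
      _ ≤ 1 / 2 * T := mul_le_mul_of_nonneg_right hfrac (by linarith)
      _ = T / 2 := by ring
  linarith

/-- The same lower bound makes `S` bounded below on the ray: `S(t) ≥ −C − 1` for `t ≥ T₀`
(`S = N − θ/π − 1 ≥ N₀ − θ/π − 1`). [cite: TrudgianGram2011, §4.3] -/
theorem zetaArgS_ge_of_criticalZeroCount_ge {C T₀ : ℝ}
    (hC : ∀ t, T₀ ≤ t → riemannSiegelTheta t / π - C ≤ criticalZeroCount t) (t : ℝ)
    (ht : T₀ ≤ t) : -C - 1 ≤ zetaArgS t := by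
  have h1 := hC t ht
  have h2 : (criticalZeroCount t : ℝ) ≤ zetaZeroCount t := by
    exact_mod_cast Literature.NumberTheory.DiophantineGeometry.criticalZeroCount_le t
  rw [zetaArgS]
  linarith

/-- **Given Landau's theorem, `N₀(t) ≥ θ(t)/π − C` cannot hold on any ray**: it would leave only
finitely many zeros off the line (Littlewood) and make `S` bounded below, which Landau 1911 /
Bohr–Landau forbid (Trudgian §4.3: "But by the weaker form of Theorem 4.2, a finite number of
exceptions to the Riemann hypothesis implies that `S(t)` assumes arbitrarily large negative
values. This contradiction …"). [cite: TrudgianGram2011, §4.3] -/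
theorem not_exists_criticalZeroCount_ge_of_landau (h : Landau1911_zetaArgS_not_bddBelow) :
    ¬ ∃ C T₀ : ℝ, ∀ t, T₀ ≤ t → riemannSiegelTheta t / π - C ≤ criticalZeroCount t := by
  rintro ⟨C, T₀, hC⟩
  obtain ⟨q, hq⟩ := exists_forall_re_eq_half_of_criticalZeroCount_ge hC
  exact h q hq ⟨-C - 1, T₀, fun t ht ↦ zetaArgS_ge_of_criticalZeroCount_ge hC t ht⟩

/-! ### The theorems on the Bohr–Landau route -/

/-- **Trudgian 2011, Theorem 7.3, conditional on Landau 1911 / Bohr–Landau** (the route of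
Trudgian's footnote 6 and Edwards §8.4, with Littlewood's theorem proved): there is no `T₀`
beyond which every Gram block satisfies the Weak Rosser Rule. [cite: TrudgianGram2011, Thm. 7.3 (footnote 6)] -/
theorem TrudgianGram2011_thm7_3_of_landau (h : Landau1911_zetaArgS_not_bddBelow) :
    TrudgianGram2011_thm7_3 := by
  rintro ⟨T₀, H⟩
  obtain ⟨g, hg⟩ := exists_gramPoint_seq
  obtain ⟨a₀, ha₀⟩ := exists_le_gramPoint hg T₀
  refine not_exists_criticalZeroCount_ge_of_landau h
    ⟨(a₀ : ℝ) + 5 - criticalZeroCount (g a₀), g a₀, fun t ht ↦ ?_⟩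
  have := criticalZeroCount_ge_of_weakRosser hg ha₀ (fun n l hb hT ↦ H n l g hb hT) ht
  linarith

/-- **Titchmarsh 1935, conditional on Landau 1911 / Bohr–Landau** (Trudgian §4.3 as printed,
with Littlewood's theorem proved): infinitely many Gram points are bad.
[cite: TrudgianGram2011, §4.3] -/
theorem Titchmarsh1935_badGramPoints_of_landau (h : Landau1911_zetaArgS_not_bddBelow) :
    Titchmarsh1935_badGramPoints := by
  by_contra hfin
  obtain ⟨g, hg⟩ := exists_gramPoint_seq
  obtain ⟨M, hM⟩ := exists_forall_isGoodGram_of_not_badGramPoints hg hfin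
  have H := weakRosserRule_of_forall_isGoodGram hg hM
  refine not_exists_criticalZeroCount_ge_of_landau h
    ⟨(M : ℝ) + 5 - criticalZeroCount (g M), g M, fun t ht ↦ ?_⟩
  have := criticalZeroCount_ge_of_weakRosser hg le_rfl H ht
  linarith

/-- **The barrier `GramRosserFailures` from Landau's theorem** (the classical Titchmarsh/Edwards
route, as an alternative to `GramRosserFailures_of_selberg`). [cite: TrudgianGram2011, §4.3 and Thm. 7.3] -/
theorem GramRosserFailures_of_landau (h : Landau1911_zetaArgS_not_bddBelow) : GramRosserFailures :=
  GramRosserFailures_of (Titchmarsh1935_badGramPoints_of_landau h)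
    (TrudgianGram2011_thm7_3_of_landau h)

/-! ### Edwards' sign-change form of Rosser's rule -/

section GramSeq

variable {g : ℕ → ℝ}

/-- `k` strict sign changes of `Z` along points `0 ≤ t_0 < ⋯ < t_k` give `N₀(t_0) + k ≤ N₀(t_k)`
(each sign change is an odd number of zeros, `odd_criticalZeroCount_add_of_hardyZ_mul_neg`).
[cite: Edwards1974, §8.3] -/
theorem criticalZeroCount_add_le_of_sign_changes {k : ℕ} (t : Fin (k + 1) → ℝ)
    (ht : StrictMono t) (h0 : 0 ≤ t 0)
    (hsign : ∀ i : Fin k, hardyZ (t i.castSucc) * hardyZ (t i.succ) < 0) :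
    ∀ i : Fin (k + 1), criticalZeroCount (t 0) + (i : ℕ) ≤ criticalZeroCount (t i) := by
  intro ⟨i, hi⟩
  induction i with
  | zero => simp
  | succ i ih =>
    have hi' : i < k + 1 := by omega
    have hik : i < k := by omega
    have hIH := ih hi'
    have hsc : hardyZ (t ⟨i, hi'⟩) * hardyZ (t ⟨i + 1, hi⟩) < 0 := hsign ⟨i, hik⟩
    have hlt : (⟨i, hi'⟩ : Fin (k + 1)) < ⟨i + 1, hi⟩ := Fin.mk_lt_mk.2 (Nat.lt_succ_self i)
    have h0a : 0 ≤ t ⟨i, hi'⟩ := h0.trans (ht.monotone (Fin.zero_le _))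
    have hodd := odd_criticalZeroCount_add_of_hardyZ_mul_neg h0a (ht hlt).le hsc
    have hmono := criticalZeroCount_mono (ht hlt).le
    rw [Nat.odd_iff] at hodd
    simp only at hIH ⊢
    omega

/-- **Rosser's rule in Edwards' sign-change form implies the Weak Rosser Rule** for the same Gram
block (`k` sign changes on `[g_n, g_{n+k}]` give `k` zeros, with multiplicity, in
`(g_n, g_{n+k}]`; the first sample point may be `g_n` itself, where a sign change starting at
`g_n` still locates its zeros in `(g_n, ·]`). [cite: Edwards1974, §8.4] -/
theorem weakRosserRule_of_edwardsRosserRule {n k : ℕ} (hn : IsGramPoint n (g n))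
    (h : EdwardsRosserRule n k g) : WeakRosserRule n k g := by
  obtain ⟨t, ht, hmem, hsign⟩ := h
  have h0 : 0 ≤ t 0 := by linarith [(hmem 0).1, hn.1]
  have hk := criticalZeroCount_add_le_of_sign_changes t ht h0 hsign (Fin.last k)
  simp only [Fin.val_last] at hk
  have h1 : criticalZeroCount (g n) ≤ criticalZeroCount (t 0) := criticalZeroCount_mono (hmem 0).1
  have h2 : criticalZeroCount (t (Fin.last k)) ≤ criticalZeroCount (g (n + k)) :=
    criticalZeroCount_mono (hmem _).2
  change k + criticalZeroCount (g n) ≤ criticalZeroCount (g (n + k))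
  omega

end GramSeq

/-- **Edwards' route fact `Edwards1974_rosserRule_implies_RH`, conditional on Landau 1911**: its
hypothesis (Rosser's rule, sign-change form, in *every* Gram block) implies the Weak Rosser Rule in
every Gram block, which `TrudgianGram2011_thm7_3_of_landau` refutes — so the implication holds
(vacuously, which is the content of the barrier). [cite: Edwards1974, §8.4] -/
theorem Edwards1974_rosserRule_implies_RH_of_landau (h : Landau1911_zetaArgS_not_bddBelow) :
    Edwards1974_rosserRule_implies_RH := by
  intro hR
  exfalso
  refine TrudgianGram2011_thm7_3_of_landau h ⟨0, fun n l g' hb _ ↦ ?_⟩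
  exact weakRosserRule_of_edwardsRosserRule (hb.2.1 n le_rfl (Nat.le_add_right n l)) (hR n l g' hb)

/-- The same, conditional on Selberg's `Ω`-theorem instead. [cite: Edwards1974, §8.4] -/
theorem Edwards1974_rosserRule_implies_RH_of_selberg (h : Selberg1946_zetaArgS_omega) :
    Edwards1974_rosserRule_implies_RH := by
  intro hR
  exfalso
  refine TrudgianGram2011_thm7_3_of_selberg h ⟨0, fun n l g' hb _ ↦ ?_⟩
  exact weakRosserRule_of_edwardsRosserRule (hb.2.1 n le_rfl (Nat.le_add_right n l)) (hR n l g' hb)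

end Literature.Barriers.RiemannHypothesis
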